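import Mathlib
import Summits.Ventures.PercRepro2.EdgeCubic
import Summits.Ventures.PercRepro2.LeafStep

/-!
# The one-edge cubic of row (LEAF-½): the Bernstein coefficients `B1h`, `B2h` of `R½` along an edge
(blind cell PercRepro2, p5 g29; `proofs/P5-OEDGE.md` §39 (8), (12))

Along any edge `e` with `t = p e`, every mass of `R½` (`LeafStep.Rhalf`) is affine in `t`
(`prob_eq_pin`), and `R½` is a homogeneous cubic form in its fifteen masses (`RhalfPoly`; the
monomial `Q·mU_o·mU_b` of `T₀` cancels against `½Gc′`, thirteen monomials remain); so `R½` is a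
cubic in `t`, in the Bernstein basis (**`Rhalf_pin_cubic`**)

  `R½ p = (1 − t)³·R½ p[e↦0] + t(1 − t)²·B1h + t²(1 − t)·B2h + t³·R½ p[e↦1]`

with `B1h`, `B2h` the POLARISED cubic form — each monomial `x·y·z` replaced by
`x₁y₀z₀ + x₀y₁z₀ + x₀y₀z₁` resp. `x₁y₁z₀ + x₁y₀z₁ + x₀y₁z₁` (`B1hPoly`, `B2hPoly`; the same
construction as `EdgeCubic.B1`, `B2` for `Gc`).  **`LeafRow_of_update_zero_of_bern`**: the row at
`p[e↦0]` and at `p[e↦1]` together with `0 ≤ B1h`, `0 ≤ B2h` give the row at `p`.  At a PENDANT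
ROOT edge the closed pin is the isolated root with `R½ = 0` and `B1h ≥ 0` is a theorem
(`LeafRowPendantRootFO.lean`); `B2h ≥ 0` there is the candidate (PROOT-½).  Own work; standard
axioms.
-/

namespace Summit.Ventures.PercRepro2

open UnionCluster CovForm CovForm.EdgeLine LeafStep

namespace LeafRowEdgeCubic

section Polar

variable {R : Type*} [Field R] [LinearOrder R] [IsStrictOrderedRing R]

omit [LinearOrder R] [IsStrictOrderedRing R] in
/-- `R½` as a polynomial in its fifteen masses: `T₀ + ½Gc′`. -/
def RhalfPoly (Q EQbo EQb3 EQb3o EQo EQ3 EQ3o PDb PDbo Do gap mUo mUb mUv mUU : R) : R :=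
  Q ^ 2 * EQbo + gap * Q * EQo + Q * (mUo * mUb - Q * mUU) +
    (Q * (-mUv * EQbo + mUo * EQb3 - Q * EQb3o) +
      gap * (-mUv * EQo + mUo * EQ3 - Q * EQ3o) +
      Q * (-(mUo - Do) * mUb - mUo * (mUb - PDb) + mUv * mUU + Q * (mUU - PDbo))) / 2

omit [LinearOrder R] [IsStrictOrderedRing R] in
/-- The one-copy polarisation `B1hPoly` of the cubic form of `R½`: each monomial `x·y·z` replaced by
`x₁y₀z₀ + x₀y₁z₀ + x₀y₀z₁`. -/
def B1hPoly (Q₀ EQbo₀ EQb3₀ EQb3o₀ EQo₀ EQ3₀ EQ3o₀ PDb₀ PDbo₀ Do₀ gap₀ mUo₀ mUb₀ mUv₀ mUU₀ Q₁ EQbo₁ EQb3₁ EQb3o₁ EQo₁ EQ3₁ EQ3o₁ PDb₁ PDbo₁ Do₁ gap₁ mUo₁ mUb₁ mUv₁ mUU₁ : R) : R :=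
  (1 / 2 : R) * (EQ3₁ * gap₀ * mUo₀ + EQ3₀ * gap₁ * mUo₀ + EQ3₀ * gap₀ * mUo₁) +
  (-1 / 2 : R) * (EQo₁ * gap₀ * mUv₀ + EQo₀ * gap₁ * mUv₀ + EQo₀ * gap₀ * mUv₁) +
  (1 / 2 : R) * (Q₁ * mUv₀ * mUU₀ + Q₀ * mUv₁ * mUU₀ + Q₀ * mUv₀ * mUU₁) +
  (1 / 2 : R) * (Q₁ * Do₀ * mUb₀ + Q₀ * Do₁ * mUb₀ + Q₀ * Do₀ * mUb₁) +
  (1 / 2 : R) * (Q₁ * PDb₀ * mUo₀ + Q₀ * PDb₁ * mUo₀ + Q₀ * PDb₀ * mUo₁) +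
  (-1 / 2 : R) * (Q₁ * EQ3o₀ * gap₀ + Q₀ * EQ3o₁ * gap₀ + Q₀ * EQ3o₀ * gap₁) +
  1 * (Q₁ * EQo₀ * gap₀ + Q₀ * EQo₁ * gap₀ + Q₀ * EQo₀ * gap₁) +
  (1 / 2 : R) * (Q₁ * EQb3₀ * mUo₀ + Q₀ * EQb3₁ * mUo₀ + Q₀ * EQb3₀ * mUo₁) +
  (-1 / 2 : R) * (Q₁ * EQbo₀ * mUv₀ + Q₀ * EQbo₁ * mUv₀ + Q₀ * EQbo₀ * mUv₁) +
  (-1 / 2 : R) * (Q₁ * Q₀ * mUU₀ + Q₀ * Q₁ * mUU₀ + Q₀ * Q₀ * mUU₁) +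
  (-1 / 2 : R) * (Q₁ * Q₀ * PDbo₀ + Q₀ * Q₁ * PDbo₀ + Q₀ * Q₀ * PDbo₁) +
  (-1 / 2 : R) * (Q₁ * Q₀ * EQb3o₀ + Q₀ * Q₁ * EQb3o₀ + Q₀ * Q₀ * EQb3o₁) +
  1 * (Q₁ * Q₀ * EQbo₀ + Q₀ * Q₁ * EQbo₀ + Q₀ * Q₀ * EQbo₁)

omit [LinearOrder R] [IsStrictOrderedRing R] in
/-- The two-copy polarisation `B2hPoly` of the cubic form of `R½`: each monomial `x·y·z` replaced by
`x₁y₁z₀ + x₁y₀z₁ + x₀y₁z₁`. -/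
def B2hPoly (Q₀ EQbo₀ EQb3₀ EQb3o₀ EQo₀ EQ3₀ EQ3o₀ PDb₀ PDbo₀ Do₀ gap₀ mUo₀ mUb₀ mUv₀ mUU₀ Q₁ EQbo₁ EQb3₁ EQb3o₁ EQo₁ EQ3₁ EQ3o₁ PDb₁ PDbo₁ Do₁ gap₁ mUo₁ mUb₁ mUv₁ mUU₁ : R) : R :=
  (1 / 2 : R) * (EQ3₁ * gap₁ * mUo₀ + EQ3₁ * gap₀ * mUo₁ + EQ3₀ * gap₁ * mUo₁) +
  (-1 / 2 : R) * (EQo₁ * gap₁ * mUv₀ + EQo₁ * gap₀ * mUv₁ + EQo₀ * gap₁ * mUv₁) +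
  (1 / 2 : R) * (Q₁ * mUv₁ * mUU₀ + Q₁ * mUv₀ * mUU₁ + Q₀ * mUv₁ * mUU₁) +
  (1 / 2 : R) * (Q₁ * Do₁ * mUb₀ + Q₁ * Do₀ * mUb₁ + Q₀ * Do₁ * mUb₁) +
  (1 / 2 : R) * (Q₁ * PDb₁ * mUo₀ + Q₁ * PDb₀ * mUo₁ + Q₀ * PDb₁ * mUo₁) +
  (-1 / 2 : R) * (Q₁ * EQ3o₁ * gap₀ + Q₁ * EQ3o₀ * gap₁ + Q₀ * EQ3o₁ * gap₁) +
  1 * (Q₁ * EQo₁ * gap₀ + Q₁ * EQo₀ * gap₁ + Q₀ * EQo₁ * gap₁) +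
  (1 / 2 : R) * (Q₁ * EQb3₁ * mUo₀ + Q₁ * EQb3₀ * mUo₁ + Q₀ * EQb3₁ * mUo₁) +
  (-1 / 2 : R) * (Q₁ * EQbo₁ * mUv₀ + Q₁ * EQbo₀ * mUv₁ + Q₀ * EQbo₁ * mUv₁) +
  (-1 / 2 : R) * (Q₁ * Q₁ * mUU₀ + Q₁ * Q₀ * mUU₁ + Q₀ * Q₁ * mUU₁) +
  (-1 / 2 : R) * (Q₁ * Q₁ * PDbo₀ + Q₁ * Q₀ * PDbo₁ + Q₀ * Q₁ * PDbo₁) +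
  (-1 / 2 : R) * (Q₁ * Q₁ * EQb3o₀ + Q₁ * Q₀ * EQb3o₁ + Q₀ * Q₁ * EQb3o₁) +
  1 * (Q₁ * Q₁ * EQbo₀ + Q₁ * Q₀ * EQbo₁ + Q₀ * Q₁ * EQbo₁)

/-- **The polarisation identity**: `RhalfPoly` of affine interpolations of the masses in the
Bernstein basis. -/
lemma RhalfPoly_pin (t Q₀ EQbo₀ EQb3₀ EQb3o₀ EQo₀ EQ3₀ EQ3o₀ PDb₀ PDbo₀ Do₀ gap₀ mUo₀ mUb₀ mUv₀ mUU₀ Q₁ EQbo₁ EQb3₁ EQb3o₁ EQo₁ EQ3₁ EQ3o₁ PDb₁ PDbo₁ Do₁ gap₁ mUo₁ mUb₁ mUv₁ mUU₁ : R) :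
    RhalfPoly (t * Q₁ + (1 - t) * Q₀) (t * EQbo₁ + (1 - t) * EQbo₀) (t * EQb3₁ + (1 - t) * EQb3₀)
      (t * EQb3o₁ + (1 - t) * EQb3o₀) (t * EQo₁ + (1 - t) * EQo₀) (t * EQ3₁ + (1 - t) * EQ3₀)
      (t * EQ3o₁ + (1 - t) * EQ3o₀) (t * PDb₁ + (1 - t) * PDb₀) (t * PDbo₁ + (1 - t) * PDbo₀)
      (t * Do₁ + (1 - t) * Do₀) (t * gap₁ + (1 - t) * gap₀) (t * mUo₁ + (1 - t) * mUo₀)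
      (t * mUb₁ + (1 - t) * mUb₀) (t * mUv₁ + (1 - t) * mUv₀) (t * mUU₁ + (1 - t) * mUU₀) =
    (1 - t) ^ 3 * RhalfPoly Q₀ EQbo₀ EQb3₀ EQb3o₀ EQo₀ EQ3₀ EQ3o₀ PDb₀ PDbo₀ Do₀ gap₀ mUo₀ mUb₀ mUv₀ mUU₀ +
      t * (1 - t) ^ 2 * B1hPoly Q₀ EQbo₀ EQb3₀ EQb3o₀ EQo₀ EQ3₀ EQ3o₀ PDb₀ PDbo₀ Do₀ gap₀ mUo₀ mUb₀ mUv₀ mUU₀ Q₁ EQbo₁ EQb3₁ EQb3o₁ EQo₁ EQ3₁ EQ3o₁ PDb₁ PDbo₁ Do₁ gap₁ mUo₁ mUb₁ mUv₁ mUU₁ +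
      t ^ 2 * (1 - t) * B2hPoly Q₀ EQbo₀ EQb3₀ EQb3o₀ EQo₀ EQ3₀ EQ3o₀ PDb₀ PDbo₀ Do₀ gap₀ mUo₀ mUb₀ mUv₀ mUU₀ Q₁ EQbo₁ EQb3₁ EQb3o₁ EQo₁ EQ3₁ EQ3o₁ PDb₁ PDbo₁ Do₁ gap₁ mUo₁ mUb₁ mUv₁ mUU₁ +
      t ^ 3 * RhalfPoly Q₁ EQbo₁ EQb3₁ EQb3o₁ EQo₁ EQ3₁ EQ3o₁ PDb₁ PDbo₁ Do₁ gap₁ mUo₁ mUb₁ mUv₁ mUU₁ := by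
  unfold RhalfPoly B1hPoly B2hPoly
  ring

end Polar

section Masses

variable {V : Type*} {E : Type*} [Fintype E] [DecidableEq E] {R : Type*} [Field R] [LinearOrder R]
  [IsStrictOrderedRing R]

omit [LinearOrder R] [IsStrictOrderedRing R] in
/-- Pinning of `mU`. -/
lemma mU_pin (p : E → R) (ends : E → Sym2 V) (a₁ a₂ x : V) (e : E) :
    mU p ends a₁ a₂ x =
      p e * mU (Function.update p e 1) ends a₁ a₂ x +
        (1 - p e) * mU (Function.update p e 0) ends a₁ a₂ x := by
  unfold mU
  rw [prob_eq_pin p _ e, prob_eq_pin p _ e]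
  ring

omit [LinearOrder R] [IsStrictOrderedRing R] in
/-- Pinning of `mUU`. -/
lemma mUU_pin (p : E → R) (ends : E → Sym2 V) (o a₁ a₂ b : V) (e : E) :
    mUU p ends o a₁ a₂ b =
      p e * mUU (Function.update p e 1) ends o a₁ a₂ b +
        (1 - p e) * mUU (Function.update p e 0) ends o a₁ a₂ b := by
  unfold mUU
  rw [prob_eq_pin p _ e, prob_eq_pin p _ e, prob_eq_pin p _ e, prob_eq_pin p _ e]
  ring

/-- `R½` is `RhalfPoly` of its fifteen masses. -/
lemma Rhalf_eq_RhalfPoly (p : E → R) (ends : E → Sym2 V) (o a₁ a₂ v b : V) :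
    Rhalf p ends o a₁ a₂ v b = RhalfPoly (prob p (avoidAll ends a₂ {a₁})) (EQbo p ends o a₁ a₂ b)
      (EQb3 p ends a₁ a₂ v b) (EQb3o p ends o a₁ a₂ v b) (EQo p ends o a₁ a₂) (EQ3 p ends a₁ a₂ v)
      (EQ3o p ends o a₁ a₂ v) (PDb p ends a₁ a₂ v b) (PDbo p ends o a₁ a₂ v b) (Do p ends o a₁ a₂ v)
      (gap p ends a₁ a₂ b) (mU p ends a₁ a₂ o) (mU p ends a₁ a₂ b) (mU p ends a₁ a₂ v)
      (mUU p ends o a₁ a₂ b) := by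
  unfold Rhalf T0 Gc1 RhalfPoly
  ring

omit [LinearOrder R] [IsStrictOrderedRing R] in
/-- **The one-copy Bernstein coefficient `B1h`** of `R½` along the edge `e`. -/
noncomputable def B1h (p : E → R) (ends : E → Sym2 V) (o a₁ a₂ v b : V) (e : E) : R :=
  B1hPoly
    (prob (Function.update p e 0) (avoidAll ends a₂ {a₁})) (EQbo (Function.update p e 0) ends o a₁ a₂ b)
    (EQb3 (Function.update p e 0) ends a₁ a₂ v b) (EQb3o (Function.update p e 0) ends o a₁ a₂ v b)
    (EQo (Function.update p e 0) ends o a₁ a₂) (EQ3 (Function.update p e 0) ends a₁ a₂ v)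
    (EQ3o (Function.update p e 0) ends o a₁ a₂ v) (PDb (Function.update p e 0) ends a₁ a₂ v b)
    (PDbo (Function.update p e 0) ends o a₁ a₂ v b) (Do (Function.update p e 0) ends o a₁ a₂ v)
    (gap (Function.update p e 0) ends a₁ a₂ b) (mU (Function.update p e 0) ends a₁ a₂ o)
    (mU (Function.update p e 0) ends a₁ a₂ b) (mU (Function.update p e 0) ends a₁ a₂ v)
    (mUU (Function.update p e 0) ends o a₁ a₂ b)
    (prob (Function.update p e 1) (avoidAll ends a₂ {a₁})) (EQbo (Function.update p e 1) ends o a₁ a₂ b)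
    (EQb3 (Function.update p e 1) ends a₁ a₂ v b) (EQb3o (Function.update p e 1) ends o a₁ a₂ v b)
    (EQo (Function.update p e 1) ends o a₁ a₂) (EQ3 (Function.update p e 1) ends a₁ a₂ v)
    (EQ3o (Function.update p e 1) ends o a₁ a₂ v) (PDb (Function.update p e 1) ends a₁ a₂ v b)
    (PDbo (Function.update p e 1) ends o a₁ a₂ v b) (Do (Function.update p e 1) ends o a₁ a₂ v)
    (gap (Function.update p e 1) ends a₁ a₂ b) (mU (Function.update p e 1) ends a₁ a₂ o)
    (mU (Function.update p e 1) ends a₁ a₂ b) (mU (Function.update p e 1) ends a₁ a₂ v)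
    (mUU (Function.update p e 1) ends o a₁ a₂ b)

omit [LinearOrder R] [IsStrictOrderedRing R] in
/-- **The two-copy Bernstein coefficient `B2h`** of `R½` along the edge `e`. -/
noncomputable def B2h (p : E → R) (ends : E → Sym2 V) (o a₁ a₂ v b : V) (e : E) : R :=
  B2hPoly
    (prob (Function.update p e 0) (avoidAll ends a₂ {a₁})) (EQbo (Function.update p e 0) ends o a₁ a₂ b)
    (EQb3 (Function.update p e 0) ends a₁ a₂ v b) (EQb3o (Function.update p e 0) ends o a₁ a₂ v b)
    (EQo (Function.update p e 0) ends o a₁ a₂) (EQ3 (Function.update p e 0) ends a₁ a₂ v)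
    (EQ3o (Function.update p e 0) ends o a₁ a₂ v) (PDb (Function.update p e 0) ends a₁ a₂ v b)
    (PDbo (Function.update p e 0) ends o a₁ a₂ v b) (Do (Function.update p e 0) ends o a₁ a₂ v)
    (gap (Function.update p e 0) ends a₁ a₂ b) (mU (Function.update p e 0) ends a₁ a₂ o)
    (mU (Function.update p e 0) ends a₁ a₂ b) (mU (Function.update p e 0) ends a₁ a₂ v)
    (mUU (Function.update p e 0) ends o a₁ a₂ b)
    (prob (Function.update p e 1) (avoidAll ends a₂ {a₁})) (EQbo (Function.update p e 1) ends o a₁ a₂ b)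
    (EQb3 (Function.update p e 1) ends a₁ a₂ v b) (EQb3o (Function.update p e 1) ends o a₁ a₂ v b)
    (EQo (Function.update p e 1) ends o a₁ a₂) (EQ3 (Function.update p e 1) ends a₁ a₂ v)
    (EQ3o (Function.update p e 1) ends o a₁ a₂ v) (PDb (Function.update p e 1) ends a₁ a₂ v b)
    (PDbo (Function.update p e 1) ends o a₁ a₂ v b) (Do (Function.update p e 1) ends o a₁ a₂ v)
    (gap (Function.update p e 1) ends a₁ a₂ b) (mU (Function.update p e 1) ends a₁ a₂ o)
    (mU (Function.update p e 1) ends a₁ a₂ b) (mU (Function.update p e 1) ends a₁ a₂ v)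
    (mUU (Function.update p e 1) ends o a₁ a₂ b)

/-- **The one-edge cubic of `R½` in the Bernstein basis** (any edge `e`, `t = p e`):
`R½ p = (1 − t)³·R½ p[e↦0] + t(1 − t)²·B1h + t²(1 − t)·B2h + t³·R½ p[e↦1]`. -/
theorem Rhalf_pin_cubic (p : E → R) (ends : E → Sym2 V) (o a₁ a₂ v b : V) (e : E) :
    Rhalf p ends o a₁ a₂ v b =
      (1 - p e) ^ 3 * Rhalf (Function.update p e 0) ends o a₁ a₂ v b +
        p e * (1 - p e) ^ 2 * B1h p ends o a₁ a₂ v b e +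
        (p e) ^ 2 * (1 - p e) * B2h p ends o a₁ a₂ v b e +
        (p e) ^ 3 * Rhalf (Function.update p e 1) ends o a₁ a₂ v b := by
  rw [Rhalf_eq_RhalfPoly p, Rhalf_eq_RhalfPoly (Function.update p e 0),
    Rhalf_eq_RhalfPoly (Function.update p e 1), prob_eq_pin p (avoidAll ends a₂ {a₁}) e,
    EQbo_pin p ends o a₁ a₂ b e, EQb3_pin p ends a₁ a₂ v b e, EQb3o_pin p ends o a₁ a₂ v b e,
    EQo_pin p ends o a₁ a₂ e, EQ3_pin p ends a₁ a₂ v e, EQ3o_pin p ends o a₁ a₂ v e,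
    PDb_pin p ends a₁ a₂ v b e, PDbo_pin p ends o a₁ a₂ v b e, Do_pin p ends o a₁ a₂ v e,
    gap_pin p ends a₁ a₂ b e, mU_pin p ends a₁ a₂ o e, mU_pin p ends a₁ a₂ b e,
    mU_pin p ends a₁ a₂ v e, mUU_pin p ends o a₁ a₂ b e]
  exact RhalfPoly_pin _ _ _ _ _ _ _ _ _ _ _ _ _ _ _ _ _ _ _ _ _ _ _ _ _ _ _ _ _ _ _

end Masses

section Closure

variable {V : Type*} {E : Type*} [Fintype E] [DecidableEq E] {R : Type*} [Field R] [LinearOrder R]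
  [IsStrictOrderedRing R]

/-- **Closure of the row along an edge from its two Bernstein coefficients**: the row at `p[e↦0]`
and `p[e↦1]` with `0 ≤ B1h` and `0 ≤ B2h` give the row at `p`. -/
theorem LeafRow_of_update_zero_of_bern (p : E → R) (hp : IsProbVec p) (ends : E → Sym2 V)
    (o a₁ a₂ v b : V) (e : E) (h₀ : LeafRow (Function.update p e 0) ends o a₁ a₂ v b)
    (h₁ : LeafRow (Function.update p e 1) ends o a₁ a₂ v b) (hB1 : 0 ≤ B1h p ends o a₁ a₂ v b e)
    (hB2 : 0 ≤ B2h p ends o a₁ a₂ v b e) : LeafRow p ends o a₁ a₂ v b := by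
  unfold LeafRow at *
  rw [Rhalf_pin_cubic p ends o a₁ a₂ v b e]
  have ht := hp.nonneg e
  have ht' : 0 ≤ 1 - p e := by linarith [hp.le_one e]
  refine add_nonneg (add_nonneg (add_nonneg ?_ ?_) ?_) ?_
  · exact mul_nonneg (pow_nonneg ht' 3) h₀
  · exact mul_nonneg (mul_nonneg ht (pow_nonneg ht' 2)) hB1
  · exact mul_nonneg (mul_nonneg (pow_nonneg ht 2) ht') hB2
  · exact mul_nonneg (pow_nonneg ht 3) h₁

end Closure

end LeafRowEdgeCubic

end Summit.Ventures.PercRepro2
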